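import Literature.Probability.LatticeModels.GoodCrossingCaseI
import Literature.Probability.LatticeModels.GoodAboveFromPinning
import Literature.Probability.LatticeModels.OrientationReflect
import Literature.Probability.LatticeModels.CoexistenceTransport
import Literature.Probability.LatticeModels.OrthogonalButterfliesCore
import Literature.Probability.LatticeModels.LevelTransport
import HarnessLib

/-!
# The two layers touch above every level with probability `≥ c₀` (contour-free GH2000 Lemma 5.4)

Topic `Probability/LatticeModels`; theorems only. Georgii–Higuchi, J. Math. Phys. 41 (2000), proof of
Lemma 5.5, Case 3 uses Lemma 5.4 ("`γ_up(ω)` and `γ_up(ω̂)` intersect each other infinitely often")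
to glue the `-∗`pin of the first layer to the `+∗`pin of the second. `GoodAboveFromPinning.lean`
takes instead, as input, a lower bound for the probability of the **touching event**
`TouchAt n (ω, ω̂)`: a site of an infinite `+∗`cluster of `S⁺(ω̂) ∩ {x₂ ≥ n}` equal or adjacent to a
site of an infinite `-`cluster of `S⁻(ω) ∩ {x₂ ≥ n}`.

This file supplies that bound without contours, for the duplicated measure `ν = μ ⊗ (μ ∘ θ_{s e₁}⁻¹)`
of a tail-trivial `μ ∈ 𝒢(β, 0)`, `β > β_c(2)`, under which both colours percolate in the upper
half-plane: **`c₀ ≤ ν(TouchAt n)` for every `n`**, `c₀ = (1 - (1 + e^{-8|β|}/2)⁻¹)/2`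
(`le_measureReal_touchAt`). At level `0` with the `+`face on the left
(`le_measureReal_touchAt_zero_of_left`) this is the comparison of the last axis sites of the infinite
`+∗`clusters of the two layers (exchangeability and the anti-concentration of the last axis site under
the horizontal shift, `le_measure_axisReach_shift`) followed by the deterministic touching criterion
`touch_of_le_maxAxis`; the `+`face on the right is the mirror image under `x₁ ↦ -x₁`
(`le_measureReal_touchAt_zero_of_right`), and level `n` is level `0` for the vertical translate
`μ ∘ θ_{-n e₂}⁻¹`, whose upper half-plane percolates in both colours by the shift lemma
(`shift_lemma_up_level`).

## References

* H.-O. Georgii, Y. Higuchi, J. Math. Phys. 41 (2000) 1153–1169, Lemma 5.4 and Lemma 5.5 (proof,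
  Case 3) [GeorgiiHiguchi2000].
-/

noncomputable section

open MeasureTheory Filter SimpleGraph
open Literature.Probability.Percolation
open scoped ENNReal

namespace Literature.Probability.LatticeModels

section Touch

variable {β : ℝ} {μ : Measure (SpinConfig (Site 2))}

/-- **Touching at level `0`, `+`face on the left.** For a tail-trivial `μ ∈ 𝒢(β, 0)`, `β > β_c(2)`,
whose upper half-plane contains an infinite `-`cluster and a `+∗`cluster with axis sites unbounded
below, `c₀ ≤ (μ ⊗ μ̂)(TouchAt 0)`, `μ̂ = μ ∘ θ_{s e₁}⁻¹`. [cite: GeorgiiHiguchi2000, Lemma 5.4 and Lemma 5.5 (proof, Case 3)] -/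
theorem le_measureReal_touchAt_zero_of_left (hβc : criticalBeta 2 < β) (hμ : μ ∈ isingGibbsMeasures 2 β 0) (s : ℤˣ)
    (hL : ∀ᵐ ω ∂μ, ∃ x, ∀ n : ℕ, ∃ k : ℤ, k < -(n : ℤ) ∧
      (![k, 0] : Site 2) ∈ siteCluster zdStarGraph (spinSites 1 ω ∩ halfPlane 0) x)
    (hC : ∀ᵐ ω ∂μ, ∃ y, (siteCluster (zdGraph 2) (spinSites (-1) ω ∩ halfPlane 0) y).Infinite) :
    ((1 - (1 + ENNReal.ofReal (Real.exp (-(8 * |β|)) / 2))⁻¹) / 2).toReal ≤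
      (μ.prod (μ.map (configShift (Pi.single 0 (s : ℤ))))).real
        {p : SpinConfig (Site 2) × SpinConfig (Site 2) | TouchAt 0 p} := by
  classical
  have hμG : IsGibbsMeasure (isingSpecification (zdGraph 2) β 0) μ := hμ
  haveI := hμG.isProbabilityMeasure
  set T : SpinConfig (Site 2) → SpinConfig (Site 2) := ⇑(configShift (S := ℤˣ) (Pi.single (0 : Fin 2) (s : ℤ))) with hT
  set μ' : Measure (SpinConfig (Site 2)) := μ.map T with hμ'
  have hμ'G : μ' ∈ isingGibbsMeasures 2 β 0 := mem_isingGibbsMeasures_map_configShift hμ _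
  have hμ'GG : IsGibbsMeasure (isingSpecification (zdGraph 2) β 0) μ' := hμ'G
  haveI : IsProbabilityMeasure μ' := hμ'GG.isProbabilityMeasure
  -- the comparison event
  set R : ℤ → Set (SpinConfig (Site 2)) := fun j =>
    {ω : SpinConfig (Site 2) | ∃ k : ℤ, j ≤ k ∧ (siteCluster zdStarGraph (spinSites 1 ω ∩ halfPlane 0) ![k, 0]).Infinite} with hR
  set Cmp := {p : SpinConfig (Site 2) × SpinConfig (Site 2) | ∃ j : ℤ, p.1 ∉ R (j + 1) ∧ p.2 ∈ R j} with hCmp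
  have hexists : ∀ᵐ ω ∂μ, ∃ j : ℤ, ω ∈ R j \ R (j + 1) := by
    filter_upwards [ae_exists_lastAxisSite hβc hμ, hL, hC] with ω h hLω hCω
    exact h hLω hCω
  have h1 : (1 - (1 + ENNReal.ofReal (Real.exp (-(8 * |β|)) / 2))⁻¹) / 2 ≤ (μ.prod μ') Cmp :=
    le_measure_axisReach_shift hμ hexists s
  -- the almost-sure structure of the two layers
  have key1 : ∀ᵐ ω ∂μ, ((∃ j : ℤ, ω ∈ R j \ R (j + 1)) ∧
      (∃ yC, (siteCluster (zdGraph 2) (spinSites (-1) ω ∩ halfPlane 0) yC).Infinite) ∧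
      (∃ x₀, ∀ n : ℕ, ∃ k : ℤ, k < -(n : ℤ) ∧ (![k, 0] : Site 2) ∈ siteCluster zdStarGraph (spinSites 1 ω ∩ halfPlane 0) x₀)) ∧
      ((∀ x₀ y₁ y₂, (siteCluster zdStarGraph (spinSites 1 ω ∩ halfPlane 0) x₀).Infinite →
          (siteCluster (zdGraph 2) (spinSites (-1) ω ∩ halfPlane 0) y₁).Infinite →
          (siteCluster (zdGraph 2) (spinSites (-1) ω ∩ halfPlane 0) y₂).Infinite →
          siteCluster (zdGraph 2) (spinSites (-1) ω ∩ halfPlane 0) y₁ = siteCluster (zdGraph 2) (spinSites (-1) ω ∩ halfPlane 0) y₂) ∧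
        (∀ x₁ x₂ y₀, (siteCluster zdStarGraph (spinSites 1 ω ∩ halfPlane 0) x₁).Infinite →
          (siteCluster zdStarGraph (spinSites 1 ω ∩ halfPlane 0) x₂).Infinite →
          (siteCluster (zdGraph 2) (spinSites (-1) ω ∩ halfPlane 0) y₀).Infinite →
          siteCluster zdStarGraph (spinSites 1 ω ∩ halfPlane 0) x₁ = siteCluster zdStarGraph (spinSites 1 ω ∩ halfPlane 0) x₂) ∧
        (∀ x₀ y₀, (siteCluster zdStarGraph (spinSites 1 ω ∩ halfPlane 0) x₀).Infinite →
          (siteCluster (zdGraph 2) (spinSites (-1) ω ∩ halfPlane 0) y₀).Infinite →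
          (∀ a k : ℤ, (![a, 0] : Site 2) ∈ siteCluster zdStarGraph (spinSites 1 ω ∩ halfPlane 0) x₀ →
              (![k, 0] : Site 2) ∈ siteCluster (zdGraph 2) (spinSites (-1) ω ∩ halfPlane 0) y₀ → a < k) ∨
            (∀ a k : ℤ, (![a, 0] : Site 2) ∈ siteCluster zdStarGraph (spinSites 1 ω ∩ halfPlane 0) x₀ →
              (![k, 0] : Site 2) ∈ siteCluster (zdGraph 2) (spinSites (-1) ω ∩ halfPlane 0) y₀ → k < a)) ∧
        (∀ y₀, (siteCluster (zdGraph 2) (spinSites (-1) ω ∩ halfPlane 0) y₀).Infinite →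
          ∀ n : ℕ, ∃ z ∈ siteCluster (zdGraph 2) (spinSites (-1) ω ∩ halfPlane 0) y₀, z 1 = 0 ∧ (n : ℤ) < |z 0|)) := by
    filter_upwards [hexists, hC, hL, ae_minus_cluster_unique hβc hμ, ae_plusStar_cluster_unique hβc hμ,
      ae_plusStar_minus_sides hβc hμ, ae_minus_touches_axis_io (G := zdGraph 2) hβc le_rfl zdGraph_le_zdStarGraph hμ]
      with ω h1 h2 h3 h4 h5 h6 h7
    exact ⟨⟨h1, h2, h3⟩, h4, h5, h6, h7⟩
  have hae1 := (Measure.quasiMeasurePreserving_fst (μ := μ) (ν := μ')).ae key1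
  have hincl : ∀ᵐ p ∂(μ.prod μ'), p ∈ Cmp → TouchAt 0 p := by
    filter_upwards [hae1] with p h1 hp
    obtain ⟨⟨⟨j₀, hj₀, hj₀'⟩, ⟨yC, hyC⟩, ⟨x₀, hLω⟩⟩, huniqC, huniqD, hsides, htouchC⟩ := h1
    obtain ⟨j, hp1, hp2⟩ := hp
    set ω := p.1 with hω
    set ω' := p.2 with hω'
    -- the last axis site `a` of the first layer
    obtain ⟨a, hja, hDinf⟩ := hj₀
    have hamax : ∀ k : ℤ, (siteCluster zdStarGraph (spinSites 1 ω ∩ halfPlane 0) ![k, 0]).Infinite → k ≤ a := by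
      intro k hk
      by_contra hlt
      exact hj₀' ⟨k, by omega, hk⟩
    have haD : (![a, 0] : Site 2) ∈ siteCluster zdStarGraph (spinSites 1 ω ∩ halfPlane 0) ![a, 0] :=
      (mem_siteCluster_self_iff _ _ _).2 hDinf.nonempty.some_mem.1
    have hmax : ∀ k : ℤ, (![k, 0] : Site 2) ∈ siteCluster zdStarGraph (spinSites 1 ω ∩ halfPlane 0) ![a, 0] → k ≤ a := by
      intro k hk
      refine hamax k ?_
      rw [siteCluster_eq_of_mem ((mem_siteCluster_self_iff _ _ _).2 hk.2.1) hk]; exact hDinf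
    have hx₀inf := infinite_of_axis_unbounded_below hLω
    have hDx₀ : siteCluster zdStarGraph (spinSites 1 ω ∩ halfPlane 0) x₀ = siteCluster zdStarGraph (spinSites 1 ω ∩ halfPlane 0) ![a, 0] :=
      huniqD x₀ _ yC hx₀inf hDinf hyC
    have hside : ∀ y₀, (siteCluster (zdGraph 2) (spinSites (-1) ω ∩ halfPlane 0) y₀).Infinite →
        ∀ b k : ℤ, (![b, 0] : Site 2) ∈ siteCluster zdStarGraph (spinSites 1 ω ∩ halfPlane 0) ![a, 0] →
          (![k, 0] : Site 2) ∈ siteCluster (zdGraph 2) (spinSites (-1) ω ∩ halfPlane 0) y₀ → b < k := by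
      intro y₀ hy₀
      rcases hsides (![a, 0]) y₀ hDinf hy₀ with h | h
      · exact h
      · exfalso
        obtain ⟨zk, hzk, hzk1, -⟩ := htouchC y₀ hy₀ 0
        have hk : (![zk 0, 0] : Site 2) ∈ siteCluster (zdGraph 2) (spinSites (-1) ω ∩ halfPlane 0) y₀ := by
          rw [← eq_axis_of_apply_one hzk1]; exact hzk
        obtain ⟨b, hb, hbD⟩ := hLω (zk 0).natAbs
        rw [hDx₀] at hbD
        have := h b (zk 0) hbD hk
        omega
    -- the second layer's cluster through `(k', 0)`, `k' ≥ j ≥ a`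
    obtain ⟨k', hjk', hinf'⟩ := hp2
    have hak' : a ≤ k' := by
      have : ¬ (j + 1 ≤ a) := fun h => hp1 ⟨a, h, hDinf⟩
      omega
    have ha'D' : (![k', 0] : Site 2) ∈ siteCluster zdStarGraph (spinSites 1 ω' ∩ halfPlane 0) ![k', 0] :=
      (mem_siteCluster_self_iff _ _ _).2 hinf'.nonempty.some_mem.1
    obtain ⟨z, hz, z', hz', hzz'⟩ := touch_of_le_maxAxis hDinf haD hmax hside htouchC hinf' ha'D' hak'
    have hCinf : (siteCluster (zdGraph 2) (spinSites (-1) ω ∩ halfPlane 0) ![a + 1, 0]).Infinite :=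
      infinite_minusCluster_succ_of_isMaxAxis hDinf haD hmax
    refine ⟨z, z', hzz', ?_, ?_⟩
    · have h0 : (halfPlane ((0 : ℕ) : ℤ) : Set (Site 2)) = halfPlane 0 := by rw [Nat.cast_zero]
      rw [h0, siteCluster_eq_of_mem ((mem_siteCluster_self_iff _ _ _).2 hz.2.1) hz]; exact hinf'
    · have h0 : (halfPlane ((0 : ℕ) : ℤ) : Set (Site 2)) = halfPlane 0 := by rw [Nat.cast_zero]
      rw [h0, siteCluster_eq_of_mem ((mem_siteCluster_self_iff _ _ _).2 hz'.2.1) hz']; exact hCinf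
  have hmono : (μ.prod μ') Cmp ≤ (μ.prod μ') {p | TouchAt 0 p} := measure_mono_ae hincl
  rw [measureReal_def]
  exact ENNReal.toReal_mono (measure_ne_top _ _) (h1.trans hmono)

/-- The touching event at level `0` is invariant under the reflection `x₁ ↦ -x₁` of both layers. [folklore] -/
theorem touchAt_of_touchAt_reflectZero {n : ℕ} (hn : n = 0) {p : SpinConfig (Site 2) × SpinConfig (Site 2)}
    (h : TouchAt n (configRelabel (reflectCoord (d := 2) 0).toEquiv p.1, configRelabel (reflectCoord (d := 2) 0).toEquiv p.2)) :
    TouchAt n p := by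
  -- the `∗`-automorphism of the reflection
  let φ : zdStarGraph ≃g zdStarGraph :=
    { toEquiv := (reflectCoord (d := 2) 0).toEquiv
      map_rel_iff' := by
        intro a b
        constructor
        · intro h
          have h' := (starReflectHom 0).map_rel h
          rw [starReflectHom_apply, starReflectHom_apply] at h'
          have ea : reflectCoord 0 ((reflectCoord (d := 2) 0).toEquiv a) = a := reflectCoord_reflectCoord 0 a
          have eb : reflectCoord 0 ((reflectCoord (d := 2) 0).toEquiv b) = b := reflectCoord_reflectCoord 0 b
          rw [ea, eb] at h'
          exact h'
        · intro h
          exact (starReflectHom 0).map_rel h }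
  have hφ1 : ∀ z : Site 2, (φ z) 1 = z 1 := fun z => (reflectCoord_zero_apply z).2
  have hφ1' : ∀ z : Site 2, ((reflectCoord (d := 2) 0) z) 1 = z 1 := fun z => (reflectCoord_zero_apply z).2
  have h0 : (halfPlane ((n : ℕ) : ℤ) : Set (Site 2)) = halfPlane 0 := by rw [hn, Nat.cast_zero]
  obtain ⟨z, z', hzz', hz, hz'⟩ := h
  simp only at hz hz'
  rw [h0] at hz hz'
  refine ⟨reflectCoord 0 z, reflectCoord 0 z', ?_, ?_, ?_⟩
  · rcases hzz' with rfl | hadj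
    · exact Or.inl rfl
    · exact Or.inr ((reflectCoord (d := 2) 0).map_rel_iff.2 hadj)
  · rw [h0, ← infinite_siteCluster_configRelabel_iff φ hφ1 1 p.2 (reflectCoord 0 z)]
    have : (φ (reflectCoord 0 z) : Site 2) = z := reflectCoord_reflectCoord 0 z
    rw [this]; exact hz
  · rw [h0, ← infinite_siteCluster_configRelabel_iff (reflectCoord (d := 2) 0) hφ1' (-1) p.1 (reflectCoord 0 z')]
    have : ((reflectCoord (d := 2) 0) (reflectCoord 0 z') : Site 2) = z' := reflectCoord_reflectCoord 0 z'
    rw [this]; exact hz'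

/-- **Touching at level `0`, `+`face on the right** (mirror image under `x₁ ↦ -x₁`). [cite: GeorgiiHiguchi2000, Lemma 5.4 and Lemma 5.5 (proof, Case 3)] -/
theorem le_measureReal_touchAt_zero_of_right (hβc : criticalBeta 2 < β) (hμ : μ ∈ isingGibbsMeasures 2 β 0) (s : ℤˣ)
    (hR : ∀ᵐ ω ∂μ, ∃ x, ∀ n : ℕ, ∃ k : ℤ, (n : ℤ) < k ∧
      (![k, 0] : Site 2) ∈ siteCluster zdStarGraph (spinSites 1 ω ∩ halfPlane 0) x)
    (hC : ∀ᵐ ω ∂μ, ∃ y, (siteCluster (zdGraph 2) (spinSites (-1) ω ∩ halfPlane 0) y).Infinite) :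
    ((1 - (1 + ENNReal.ofReal (Real.exp (-(8 * |β|)) / 2))⁻¹) / 2).toReal ≤
      (μ.prod (μ.map (configShift (Pi.single 0 (s : ℤ))))).real
        {p : SpinConfig (Site 2) × SpinConfig (Site 2) | TouchAt 0 p} := by
  classical
  have hμG : IsGibbsMeasure (isingSpecification (zdGraph 2) β 0) μ := hμ
  haveI := hμG.isProbabilityMeasure
  set ρ : SpinConfig (Site 2) → SpinConfig (Site 2) := ⇑(configRelabel (reflectCoord (d := 2) 0).toEquiv) with hρ
  have hρm : Measurable ρ := (configRelabel _).measurable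
  set μR : Measure (SpinConfig (Site 2)) := μ.map ρ with hμR
  have hμRG : μR ∈ isingGibbsMeasures 2 β 0 := IsGibbsMeasure.map_configRelabel _ (reflectCoord 0) hμG
  have hL' : ∀ᵐ ω ∂μR, ∃ x, ∀ n : ℕ, ∃ k : ℤ, k < -(n : ℤ) ∧
      (![k, 0] : Site 2) ∈ siteCluster zdStarGraph (spinSites 1 ω ∩ halfPlane 0) x := by
    rw [hμR, ae_map_iff hρm.aemeasurable (measurableSet_axisUnboundedBelow_config (G := zdStarGraph) 1 (halfPlane 0))]
    filter_upwards [hR] with ω ⟨x₀, hx₀⟩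
    refine ⟨reflectCoord 0 x₀, fun n => ?_⟩
    obtain ⟨k, hk, hmem⟩ := hx₀ n
    refine ⟨-k, by omega, ?_⟩
    rw [mem_siteCluster_reflectZero_iff, neg_neg, reflectCoord_reflectCoord]
    exact hmem
  have hC' : ∀ᵐ ω ∂μR, ∃ y, (siteCluster (zdGraph 2) (spinSites (-1) ω ∩ halfPlane 0) y).Infinite := by
    rw [hμR, ae_map_iff hρm.aemeasurable (MeasurableSet.of_tailEvents
      (measurableSet_tailEvents_existsInfClusterIn (G := zdGraph 2) (-1) (halfPlane 0)))]
    filter_upwards [hC] with ω ⟨y₀, hy₀⟩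
    refine ⟨reflectCoord 0 y₀, ?_⟩
    exact (infinite_siteCluster_configRelabel_iff (reflectCoord (d := 2) 0) (fun z => (reflectCoord_zero_apply z).2) (-1) ω y₀).2 hy₀
  have key := le_measureReal_touchAt_zero_of_left hβc hμRG (-s) hL' hC'
  have hprod : μR.prod (μR.map (configShift (Pi.single 0 (((-s : ℤˣ) : ℤ))))) =
      (μ.prod (μ.map (configShift (Pi.single 0 (s : ℤ))))).map (Prod.map ρ ρ) := by
    rw [Units.val_neg, hμR, hρ, map_prod_reflectZero]
  rw [hprod, measureReal_def, Measure.map_apply (hρm.prodMap hρm) (measurableSet_touchAt 0)] at key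
  rw [measureReal_def]
  refine key.trans (ENNReal.toReal_mono (measure_ne_top _ _) (measure_mono ?_))
  intro p hp
  exact touchAt_of_touchAt_reflectZero rfl hp

/-- **The two layers touch above every level with probability `≥ c₀`** (a contour-free substitute
for Georgii–Higuchi's Lemma 5.4 in the proof of Lemma 5.5, Case 3): for `β > β_c(2)`, a tail-trivial
`μ ∈ 𝒢(β, 0)` under which both an infinite `+`cluster and an infinite `-`cluster of the upper
half-plane exist almost surely, `s = ±1` and every `n`,
`c₀ ≤ (μ ⊗ (μ ∘ θ_{s e₁}⁻¹))(TouchAt n)`. [cite: GeorgiiHiguchi2000, Lemma 5.4 and Lemma 5.5 (proof, Case 3)] -/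
theorem le_measureReal_touchAt (hβc : criticalBeta 2 < β) (hμ : μ ∈ isingGibbsMeasures 2 β 0)
    (hμt : IsTailTrivial μ) (s : ℤˣ)
    (hP : ∀ᵐ ω ∂μ, ∃ x, (siteCluster (zdGraph 2) (spinSites 1 ω ∩ halfPlane 0) x).Infinite)
    (hM : ∀ᵐ ω ∂μ, ∃ y, (siteCluster (zdGraph 2) (spinSites (-1) ω ∩ halfPlane 0) y).Infinite) (n : ℕ) :
    ((1 - (1 + ENNReal.ofReal (Real.exp (-(8 * |β|)) / 2))⁻¹) / 2).toReal ≤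
      (μ.prod (μ.map (configShift (Pi.single 0 (s : ℤ))))).real
        {p : SpinConfig (Site 2) × SpinConfig (Site 2) | TouchAt n p} := by
  classical
  have hμG : IsGibbsMeasure (isingSpecification (zdGraph 2) β 0) μ := hμ
  haveI := hμG.isProbabilityMeasure
  set θ := configShift (S := ℤˣ) (Pi.single (0 : Fin 2) (s : ℤ)) with hθ
  have hθm : Measurable θ := (configShift _).measurable
  set vL : Site 2 := -((n : ℕ) : ℤ) • (Pi.single 1 1 : Site 2) with hvL
  have hvL0 : vL 0 = 0 := by simp [hvL]
  have hvL1 : vL 1 = -(n : ℤ) := by simp [hvL]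
  have hTm : Measurable (configShift (S := ℤˣ) vL : SpinConfig (Site 2) → SpinConfig (Site 2)) :=
    (configShift _).measurable
  set μL : Measure (SpinConfig (Site 2)) := μ.map (configShift vL) with hμL
  have hμLG : μL ∈ isingGibbsMeasures 2 β 0 := mem_isingGibbsMeasures_map_configShift hμ _
  have hμLt : IsTailTrivial μL := hμt.map_configRelabel (Site.shift _)
  haveI : IsProbabilityMeasure μL := Measure.isProbabilityMeasure_map hTm.aemeasurable
  -- percolation of both colours in `{x₂ ≥ n}` (shift lemma), i.e. in the upper half-plane of `μ_L`
  have hPL : ∀ᵐ ω ∂μ, ∃ x, (siteCluster (zdGraph 2) (spinSites 1 ω ∩ halfPlane n) x).Infinite :=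
    shift_lemma_up_level hμ hμt 1 hP n
  have hML : ∀ᵐ ω ∂μ, ∃ y, (siteCluster (zdGraph 2) (spinSites (-1) ω ∩ halfPlane n) y).Infinite :=
    shift_lemma_up_level hμ hμt (-1) hM n
  have hDL : ∀ᵐ ω ∂μ, ∃ x, (siteCluster zdStarGraph (spinSites 1 ω ∩ halfPlane n) x).Infinite := by
    filter_upwards [hPL] with ω ⟨x, hx⟩
    exact ⟨x, infinite_starCluster_of_latticeCluster hx⟩
  have hlev : (0 : ℤ) - vL 1 = (n : ℤ) := by rw [hvL1]; ring
  have hDL' : ∀ᵐ ω ∂μL, ∃ x, (siteCluster zdStarGraph (spinSites 1 ω ∩ halfPlane 0) x).Infinite := by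
    rw [hμL, ae_exists_infinite_cluster_map_configShift_iff_star, hlev]; exact hDL
  have hCL' : ∀ᵐ ω ∂μL, ∃ y, (siteCluster (zdGraph 2) (spinSites (-1) ω ∩ halfPlane 0) y).Infinite := by
    rw [hμL, ae_exists_infinite_cluster_map_configShift_iff_lattice, hlev]; exact hML
  -- touching at level `0` for `μ_L`, whatever the orientation
  have key : ((1 - (1 + ENNReal.ofReal (Real.exp (-(8 * |β|)) / 2))⁻¹) / 2).toReal ≤
      (μL.prod (μL.map θ)).real {p : SpinConfig (Site 2) × SpinConfig (Site 2) | TouchAt 0 p} := by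
    rcases hμLt.measure_axisUnboundedBelow (G := zdStarGraph) 1 (halfPlane 0) with h0 | h1
    · have hR : ∀ᵐ ω ∂μL, ∃ x, ∀ n : ℕ, ∃ k : ℤ, (n : ℤ) < k ∧
          (![k, 0] : Site 2) ∈ siteCluster zdStarGraph (spinSites 1 ω ∩ halfPlane 0) x := by
        filter_upwards [ae_axisUnbounded_below_or_above hβc hμLG, measure_eq_zero_iff_ae_notMem.1 h0, hDL']
          with ω hdich hnot ⟨x, hx⟩
        rcases hdich x hx with hb | ha
        · exact absurd ⟨x, hb⟩ hnot
        · exact ⟨x, ha⟩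
      exact le_measureReal_touchAt_zero_of_right hβc hμLG s hR hCL'
    · have hL : ∀ᵐ ω ∂μL, ∃ x, ∀ n : ℕ, ∃ k : ℤ, k < -(n : ℤ) ∧
          (![k, 0] : Site 2) ∈ siteCluster zdStarGraph (spinSites 1 ω ∩ halfPlane 0) x := by
        have := (prob_compl_eq_zero_iff (measurableSet_axisUnboundedBelow_config (G := zdStarGraph) 1 (halfPlane 0))).2 h1
        filter_upwards [measure_eq_zero_iff_ae_notMem.1 this] with ω hω
        exact not_not.1 hω
      exact le_measureReal_touchAt_zero_of_left hβc hμLG s hL hCL'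
  -- pull back along `T × T`
  have hprod := prod_map_configShift_comm μ (Pi.single (0 : Fin 2) (s : ℤ)) vL
  rw [measureReal_def, hprod, Measure.map_apply (hTm.prodMap hTm) (measurableSet_touchAt 0)] at key
  rw [measureReal_def]
  refine key.trans (ENNReal.toReal_mono (measure_ne_top _ _) (measure_mono ?_))
  rintro p ⟨z, z', hzz', hz, hz'⟩
  simp only [Prod.map_fst, Prod.map_snd] at hz hz'
  have hinj : Set.InjOn (fun w : Site 2 => w + vL) Set.univ := fun a _ b _ h => add_right_cancel h
  have h0n : ((0 : ℕ) : ℤ) - vL 1 = (n : ℤ) := by rw [hvL1]; simp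
  refine ⟨z - vL, z' - vL, ?_, ?_, ?_⟩
  · rcases hzz' with rfl | hadj
    · exact Or.inl rfl
    · exact Or.inr ((zdGraph_adj_sub_iff z z' vL).2 hadj)
  · have h := hz
    rw [show z = (z - vL) + vL from (sub_add_cancel z vL).symm, siteCluster_configShift_eq_image_star,
      Set.infinite_image_iff (hinj.mono (Set.subset_univ _)), h0n] at h
    exact h
  · have h := hz'
    rw [show z' = (z' - vL) + vL from (sub_add_cancel z' vL).symm, siteCluster_configShift_eq_image_lattice,
      Set.infinite_image_iff (hinj.mono (Set.subset_univ _)), h0n] at h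
    exact h

end Touch

end Literature.Probability.LatticeModels
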